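import Summits.QuantumFields.BalabanUV.Beta.GAN24.DerivativeRateTransferLoewnerGramBounded
import Summits.QuantumFields.BalabanUV.Beta.GAN24.DerivativeRateTransferLoewnerGramConverge

/-!
# `BalabanUV.Beta.GAN24.DerivativeRateTransferLoewnerGramConvergeSchedule` — binder row G-an2-4 ∕ (CONV-C), route R6 «VALUES, NOT DERIVATIVES», PART 100:
# THE RATE-FREE END UNDER THE SUPPLIERS' (STAB) FAMILY — PART 99 fed by PART 88's Peter–Paul family with the polar schedule `e_j ≤ E₀θ_p^j`, the mismatch
# schedule `τ_j ≤ M₀θ_m^j` and the growth `N₀Λ^j`: the effective forms CONVERGE as soon as `θ_p < 1` and `θ_m²Λ < 1` — NO (CONS), no `θ`, no `hrate`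
# (unit b2b-balaban-gan24-p3, gen 48; v2 — v1 p378827 bounced `dedup.landed` on the restated geometric sum; now PART 94's lemma by name)

NOT IN PRINT; OUR PROOF (for the ROUTE; PART 99 `exists_effForm_limit_of_stabGram_summable` BY NAME + the choice `s_j = r^j`, `r = (1 + θ_m²Λ)∕2`, and two
geometric sums).  HONEST FRAMING (cell contract, verbatim): «discharging `BetaPertH` makes Bałaban's UV stability UNCONDITIONAL — a real constructive-QFT result; it
is NOT the continuum limit and NOT the Clay problem.»  HONEST DEPENDENCY (verbatim): «continuum YM on T⁴ ⇐ BetaPertH ∧ nine spine estimates (0/9 proved); BetaPertH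
⇐ (D1) ∧ (D4) ∧ CAP+tail; G-an2-4 gates asym, D1 and NE2/3/4.»

WHY THIS FILE.  PART 88's scheduled END chooses `s_j = θ^j` in the family `∀ s > 0, 0 ≤ ((1+s)(1+e_j))•H_{j+1} + ((1+s⁻¹)τ_j²)•G_{j+1} − Qf_jᵀH_jQf_j` and needs
`hrate : θ_m²Λ ≤ θ²` to match (CONS)'s rate `θ`.  WITHOUT (CONS) there is no rate to match: any `r` with `θ_m²Λ < r < 1` and `s_j = r^j` makes both slacks
SUMMABLE — `ε_j = (1+r^j)(1+e_j) − 1 ≤ r^j + 2e_j`, `δ_jN_{j+1} = (1+r^{−j})τ_j²N_{j+1} ≤ M₀²N₀Λ·((θ_m²Λ)^j + (θ_m²Λ∕r)^j)` — and PART 99 gives the limit form.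
So in the sup road the EXISTENCE of `𝒮_∞` costs: the polar schedule with `θ_p < 1` (typed from plaquettes), the mismatch schedule and the growth count with
`θ_m²Λ < 1` [R9° + lattice count], and a bounded diagonal; the RATE costs (CONS) [R8°] on top (PART 96).

WHAT THIS FILE PROVES (0 sorry, 0 `def`, nothing cited; the geometric sum `Σ_{i<n}x^i ≤ 1∕(1−x)` is PART 94's `sum_range_pow_le_inv_one_sub` BY NAME): `mulSlack_summable_le`, `addSlack_summable_le`,
**`exists_effForm_limit_of_stabFamily_noCons`**.  WHAT IT DOES NOT DO: a rate; identify `𝒮_∞`.  SUPPLIER work on route C-R6° (rank 2, REDUCTION); no consumer of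
record; NEVER «G-an2-4 closed»; NOT (CONV-C), NOT D1, NOT `BetaPertH`, NOT continuum, NOT Clay.  Records: `HOME/b2b-balaban-gan24-p3/gen48/R6-LEDGER-NOTE.md`.
-/

noncomputable section

open Set Matrix Finset Filter Topology

namespace Summit.QuantumFields.BalabanUV.Beta.GAN24.DerivativeRateTransferLoewnerGramConvergeSchedule

open Literature.MathematicalPhysics.QuantumFieldTheory.Balaban1983to89.Beta.Composition (kkt)
open Literature.MathematicalPhysics.QuantumFieldTheory.Balaban1983to89.Beta.CompositionSingular (effForm minOp)
open Summit.QuantumFields.BalabanUV.Beta.GAN24.DerivativeRateTransferLoewnerGramBounded (sum_range_pow_le_inv_one_sub)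
open Summit.QuantumFields.BalabanUV.Beta.GAN24.DerivativeRateTransferLoewnerGramConverge (exists_effForm_limit_of_stabGram_summable)

/-! ## §1 The summable slacks of the choice `s_j = r^j` -/

section Scalar

variable {e τ N : ℕ → ℝ} {E₀ M₀ N₀ Λ θp θm r : ℝ}

/-- **the multiplicative slack of `s_j = r^j` is summable**: `0 ≤ e_j ≤ E₀θ_p^j`, `0 ≤ r ≤ 1` ⟹ `0 ≤ (1+r^j)(1+e_j) − 1 ≤ r^j + 2E₀θ_p^j`. [folklore] -/
theorem mulSlack_summable_le (hr0 : 0 ≤ r) (hr1 : r ≤ 1) (he : ∀ j, 0 ≤ e j ∧ e j ≤ E₀ * θp ^ j) (j : ℕ) :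
    0 ≤ (1 + r ^ j) * (1 + e j) - 1 ∧ (1 + r ^ j) * (1 + e j) - 1 ≤ r ^ j + 2 * (E₀ * θp ^ j) := by
  have hrj : 0 ≤ r ^ j := pow_nonneg hr0 j
  have hrj1 : r ^ j ≤ 1 := pow_le_one₀ hr0 hr1
  obtain ⟨he0, he1⟩ := he j
  constructor
  · nlinarith
  · nlinarith [mul_le_mul_of_nonneg_left he1 hrj]

/-- **the additive slack of `s_j = r^j` against the growth is summable**: `0 ≤ τ_j ≤ M₀θ_m^j`, `|…| ≤ N₀Λ^{j+1}`, `0 < r`, `0 ≤ θ_m, Λ, N₀` ⟹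
`(1 + (r^j)⁻¹)·τ_j²·(N₀Λ^{j+1}) ≤ M₀²N₀Λ·((θ_m²Λ)^j + (θ_m²Λ∕r)^j)` (`0 < r`, `0 ≤ Λ, N₀`). [folklore] -/
theorem addSlack_summable_le (hr : 0 < r) (hΛ : 0 ≤ Λ) (hN₀ : 0 ≤ N₀) (hτ : ∀ j, 0 ≤ τ j ∧ τ j ≤ M₀ * θm ^ j) (j : ℕ) :
    (1 + (r ^ j)⁻¹) * τ j ^ 2 * (N₀ * Λ ^ (j + 1)) ≤ M₀ ^ 2 * N₀ * Λ * ((θm ^ 2 * Λ) ^ j + (θm ^ 2 * Λ / r) ^ j) := by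
  obtain ⟨hτ0, hτ1⟩ := hτ j
  have hτ2 : τ j ^ 2 ≤ (M₀ * θm ^ j) ^ 2 := pow_le_pow_left₀ hτ0 hτ1 2
  have hrj : 0 < r ^ j := pow_pos hr j
  have hs : 0 ≤ 1 + (r ^ j)⁻¹ := by positivity
  have hNΛ : 0 ≤ N₀ * Λ ^ (j + 1) := by positivity
  have h1 : (1 + (r ^ j)⁻¹) * τ j ^ 2 * (N₀ * Λ ^ (j + 1)) ≤ (1 + (r ^ j)⁻¹) * (M₀ * θm ^ j) ^ 2 * (N₀ * Λ ^ (j + 1)) :=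
    mul_le_mul_of_nonneg_right (mul_le_mul_of_nonneg_left hτ2 hs) hNΛ
  have e1 : (1 + (r ^ j)⁻¹) * (M₀ * θm ^ j) ^ 2 * (N₀ * Λ ^ (j + 1)) = M₀ ^ 2 * N₀ * Λ * ((θm ^ 2 * Λ) ^ j + (θm ^ 2 * Λ / r) ^ j) := by
    rw [div_pow, mul_pow, mul_pow, ← pow_mul, pow_succ]
    field_simp
    ring
  rw [← e1]; exact h1

end Scalar

/-! ## §2 The rate-free END under the family -/

section Tower

variable {c : Type*} [Fintype c] [DecidableEq c]
variable {ι : ℕ → Type*} [∀ j, Fintype (ι j)] [∀ j, DecidableEq (ι j)]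
variable {H : ∀ j, Matrix (ι j) (ι j) ℝ} {Qf : ∀ j, Matrix (ι j) (ι (j + 1)) ℝ} {Qc : ∀ j, Matrix c (ι j) ℝ}
variable {G : ∀ j, Matrix (ι j) (ι j) ℝ} {e τ : ℕ → ℝ} {B E₀ M₀ N₀ Λ θp θm : ℝ}

/-- **`exists_effForm_limit_of_stabFamily_noCons` — THE RATE-FREE END UNDER THE SUPPLIERS' FAMILY** [our proof; PART 99 + the choice `s_j = r^j`,
`r = (1 + θ_m²Λ)∕2`]: PSD fine forms, nonsingular bordered matrices, `Qc (j+1) = Qc j·Qf j`, PSD carriers; the (STAB) FAMILY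
`∀ s > 0, 0 ≤ ((1+s)(1+e_j))•H_{j+1} + ((1+s⁻¹)τ_j²)•G_{j+1} − Qf_jᵀH_jQf_j`; the POLAR schedule `0 ≤ e_j ≤ E₀θ_p^j` with `0 ≤ θ_p < 1`; the MISMATCH schedule
`0 ≤ τ_j ≤ M₀θ_m^j` and the GROWTH `|(ℋ_jᵀG_jℋ_j)_{ab}| ≤ N₀Λ^j` with `0 ≤ Λ, E₀, N₀` and **`θ_m²Λ < 1`** (no sign condition on `θ_m`); a bounded diagonal `𝒮_j(a,a) ≤ B` ⟹
`∃ 𝒮_∞, ∀ a b, 𝒮_j(a,b) → 𝒮_∞(a,b)`.  No (CONS), no prolongations `P`, no rate `θ`. -/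
theorem exists_effForm_limit_of_stabFamily_noCons (hH : ∀ j, (H j).PosSemidef) (hk : ∀ j, IsUnit (kkt (H j) (Qc j)).det)
    (hcomp : ∀ j, Qc (j + 1) = Qc j * Qf j) (hGp : ∀ j, (G j).PosSemidef)
    (hstab : ∀ j (s : ℝ), 0 < s →
      ((((1 + s) * (1 + e j)) • H (j + 1) + ((1 + s⁻¹) * τ j ^ 2) • G (j + 1) - (Qf j)ᵀ * H j * Qf j).PosSemidef))
    (he : ∀ j, 0 ≤ e j ∧ e j ≤ E₀ * θp ^ j) (hτ : ∀ j, 0 ≤ τ j ∧ τ j ≤ M₀ * θm ^ j)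
    (hN : ∀ j a b, |((minOp (H j) (Qc j))ᵀ * G j * minOp (H j) (Qc j)) a b| ≤ N₀ * Λ ^ j)
    (hB : ∀ j a, effForm (H j) (Qc j) a a ≤ B)
    (hθp : 0 ≤ θp) (hθp1 : θp < 1) (hΛ : 0 ≤ Λ) (hE₀ : 0 ≤ E₀) (hN₀ : 0 ≤ N₀) (hrate : θm ^ 2 * Λ < 1) :
    ∃ Sinf : Matrix c c ℝ, ∀ a b : c, Tendsto (fun j => effForm (H j) (Qc j) a b) atTop (𝓝 (Sinf a b)) := by
  -- the ratio `r` strictly between `θ_m²Λ` and `1`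
  set q : ℝ := θm ^ 2 * Λ with hq
  have hq0 : 0 ≤ q := by positivity
  set r : ℝ := (1 + q) / 2 with hr
  have hr0 : 0 < r := by rw [hr]; linarith
  have hr1 : r < 1 := by rw [hr]; linarith
  have hqr : q / r < 1 := by rw [div_lt_one hr0, hr]; linarith
  have hqr0 : 0 ≤ q / r := div_nonneg hq0 hr0.le
  -- PART 99 with `ε_j = (1+r^j)(1+e_j) − 1`, `δ_j = (1 + r^{-j})τ_j²`, `N_j = N₀Λ^j`
  refine exists_effForm_limit_of_stabGram_summable (ε := fun j => (1 + r ^ j) * (1 + e j) - 1) (δ := fun j => (1 + (r ^ j)⁻¹) * τ j ^ 2)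
    (N := fun j => N₀ * Λ ^ j) (Sε := 1 / (1 - r) + 2 * (E₀ * (1 / (1 - θp))))
    (Sδ := M₀ ^ 2 * N₀ * Λ * (1 / (1 - q) + 1 / (1 - q / r))) hH hk hcomp hGp
    (fun j => (mulSlack_summable_le hr0.le hr1.le he j).1)
    (fun j => by have := pow_pos hr0 j; have := (hτ j).1; positivity)
    (fun j => by
      have h := hstab j (r ^ j) (pow_pos hr0 j)
      simpa only [add_sub_cancel] using h)
    (fun n => ?_) hN (fun n => ?_) hB
  · -- `Σ ε_i ≤ Σ (r^i + 2E₀θ_p^i) ≤ 1∕(1−r) + 2E₀∕(1−θ_p)`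
    calc ∑ i ∈ range n, ((1 + r ^ i) * (1 + e i) - 1) ≤ ∑ i ∈ range n, (r ^ i + 2 * (E₀ * θp ^ i)) :=
          Finset.sum_le_sum fun i _ => (mulSlack_summable_le hr0.le hr1.le he i).2
      _ = ∑ i ∈ range n, r ^ i + 2 * (E₀ * ∑ i ∈ range n, θp ^ i) := by
          rw [Finset.sum_add_distrib, Finset.mul_sum, Finset.mul_sum]
      _ ≤ 1 / (1 - r) + 2 * (E₀ * (1 / (1 - θp))) := by
          have h1 := sum_range_pow_le_inv_one_sub hr0.le hr1 n
          have h2 := mul_le_mul_of_nonneg_left (sum_range_pow_le_inv_one_sub hθp hθp1 n) hE₀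
          linarith
  · -- `Σ δ_i N_{i+1} ≤ M₀²N₀Λ·Σ(q^i + (q∕r)^i)`
    calc ∑ i ∈ range n, (1 + (r ^ i)⁻¹) * τ i ^ 2 * (N₀ * Λ ^ (i + 1))
        ≤ ∑ i ∈ range n, M₀ ^ 2 * N₀ * Λ * (q ^ i + (q / r) ^ i) :=
          Finset.sum_le_sum fun i _ => addSlack_summable_le hr0 hΛ hN₀ hτ i
      _ = M₀ ^ 2 * N₀ * Λ * (∑ i ∈ range n, q ^ i + ∑ i ∈ range n, (q / r) ^ i) := by
          rw [← Finset.sum_add_distrib, Finset.mul_sum]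
      _ ≤ M₀ ^ 2 * N₀ * Λ * (1 / (1 - q) + 1 / (1 - q / r)) := by
          have hc : 0 ≤ M₀ ^ 2 * N₀ * Λ := by positivity
          exact mul_le_mul_of_nonneg_left (add_le_add (sum_range_pow_le_inv_one_sub hq0 hrate n) (sum_range_pow_le_inv_one_sub hqr0 hqr n)) hc

end Tower

end Summit.QuantumFields.BalabanUV.Beta.GAN24.DerivativeRateTransferLoewnerGramConvergeSchedule

end
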